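import Summits.CriticalPhenomena.PercolationContinuityZ3.Theorems.PercNearOneGluingNoHeavyLowerTailSahiCoSunflowerOrClosure
import Summits.CriticalPhenomena.PercolationContinuityZ3.Theorems.PercNearOneGluingNoHeavyLowerTailSahiCoSunflowerAndClosure
import Mathlib.Tactic.Linarith
import HarnessLib

/-!
# `NoHeavyLowerTail` (crux stmt-CriticalPhenomena-4575), master-family line P1: alternating CLAUSE CHAINS as third generator, and the
# reflected Kahn-C5 statements (sunflower complements with an OR-clause petal generator)

Support file (seat `prim-masterthm-p1`, gen 9; `--supports stmt-CriticalPhenomena-4575`).  No definition, no `sorry`, standard axioms.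
Memo `run/shared/lean/prim/prim-masterthm/FROM-prim-masterthm-p1-g9-CLAUSE-CLOSURE.md` §3.

With `𝒢 = {G₃ : ∀ increasing G₁ G₂, 0 ≤ E_3(μ_p; G₂ ∪ G₃, G₁ ∪ G₃, G₁ ∪ G₂)}` (good third generators of the co-sunflower class), the closure
theorems `SahiCoSunflowerOrClosure.good_orClause` (`H ↦ O_T ∪ H`) and `SahiCoSunflowerAndClosure.good_andClause` (`K ↦ C_S ∩ K`) compose:
every alternating chain of AND-clauses `C_S = {S ⊆ ω}` and OR-clauses `O_T = {ω ∩ T ≠ ∅}` over pairwise disjoint coordinate sets is good —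
while `G₁, G₂` may use all these coordinates.  Recorded instances: `C_S ∩ O_T` (`sahiE_three_andClause_orClause_nonneg`), `O_T ∪ C_S`
(`sahiE_three_orClause_andClause_nonneg`), `C_S ∩ (O_T ∪ C_R)` (`sahiE_three_and_or_and_nonneg`).  REFLECTED FORM (`ω ↦ ωᶜ`, `p ↦ 1 − p`):
Kahn's Conjecture 5 / the tree's `(1+a)(ab − e₂) ≥ e₃` for the complements of the sunflower `(F₂ ∩ O_S, F₁ ∩ O_S, F₁ ∩ F₂)` for EVERY finite `S`
and ALL increasing `F₁, F₂` (`sahiE3_compl_sunflower_orClause_nonneg`; gen 8's `…Cylinder` file is the case `F₃ = C_S`, gen 7 the case `|S| = 1`).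
HONEST FRAMING: strata of the class law; the class law itself and Kahn's Conjecture 5 remain OPEN. [this work]
-/

noncomputable section

open scoped Classical

namespace Summit.CriticalPhenomena.PercolationContinuityZ3.Theorems

namespace SahiCoSunflowerClauseChains

open Finset Function
open Literature.Combinatorics.Sahi2008
open Literature.Probability.LatticeModels (sahiE3 prodBernoulli)
open Literature.Probability.Percolation.DecisionTree (ind ind_of_mem ind_of_not_mem ind_nonneg)

variable {ι : Type} [Fintype ι]

/-! ### 1. Two-step chains -/

/-- **`G₃ = C_S ∩ O_T`** ("all of `S` and some of `T` open", `S ∩ T = ∅`): for ALL increasing `G₁, G₂`,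
`0 ≤ E_3(μ_p; G₂ ∪ (C_S ∩ O_T), G₁ ∪ (C_S ∩ O_T), G₁ ∪ G₂)`. [this work] -/
theorem sahiE_three_andClause_orClause_nonneg (p : ι → unitInterval) {S T : Finset ι} (hST : Disjoint S T) {G₁ G₂ : Set (Set ι)}
    (h₁ : IsUpperSet G₁) (h₂ : IsUpperSet G₂) :
    0 ≤ sahiE (bernoulliWeight p) 3
      ![ind (G₂ ∪ ({ω : Set ι | ∀ e ∈ S, e ∈ ω} ∩ {ω : Set ι | ∃ e ∈ T, e ∈ ω})),
        ind (G₁ ∪ ({ω : Set ι | ∀ e ∈ S, e ∈ ω} ∩ {ω : Set ι | ∃ e ∈ T, e ∈ ω})), ind (G₁ ∪ G₂)] := by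
  refine SahiCoSunflowerAndClosure.good_andClause p S (SahiCoSunflowerOrClosure.isUpperSet_orClause T) ?_ ?_ G₁ G₂ h₁ h₂
  · intro e he b
    exact SahiCoSunflowerOrClosure.secAt_orClause_of_not_mem (Finset.disjoint_left.1 hST he) b
  · intro G₁ G₂ h₁ h₂
    exact SahiCoSunflowerOrClosure.sahiE_three_orClause_nonneg' p T h₁ h₂

/-- **`G₃ = O_T ∪ C_S`** ("some of `T` or all of `S` open", `S ∩ T = ∅`): for ALL increasing `G₁, G₂`,
`0 ≤ E_3(μ_p; G₂ ∪ (O_T ∪ C_S), G₁ ∪ (O_T ∪ C_S), G₁ ∪ G₂)`. [this work] -/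
theorem sahiE_three_orClause_andClause_nonneg (p : ι → unitInterval) {S T : Finset ι} (hST : Disjoint S T) {G₁ G₂ : Set (Set ι)}
    (h₁ : IsUpperSet G₁) (h₂ : IsUpperSet G₂) :
    0 ≤ sahiE (bernoulliWeight p) 3
      ![ind (G₂ ∪ ({ω : Set ι | ∃ e ∈ T, e ∈ ω} ∪ {ω : Set ι | ∀ e ∈ S, e ∈ ω})),
        ind (G₁ ∪ ({ω : Set ι | ∃ e ∈ T, e ∈ ω} ∪ {ω : Set ι | ∀ e ∈ S, e ∈ ω})), ind (G₁ ∪ G₂)] := by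
  refine SahiCoSunflowerOrClosure.good_orClause p T (SahiCoSunflowerAndClosure.isUpperSet_andClause S) ?_ ?_ G₁ G₂ h₁ h₂
  · intro e he b
    exact SahiCoSunflowerAndClosure.secAt_andClause_of_not_mem (Finset.disjoint_right.1 hST he) b
  · intro G₁ G₂ h₁ h₂
    exact SahiCoSunflowerAndClosure.sahiE_three_andClause_nonneg p S h₁ h₂

/-! ### 2. A three-step chain -/

/-- **`G₃ = C_S ∩ (O_T ∪ C_R)`** (`S, T, R` pairwise disjoint): for ALL increasing `G₁, G₂`,
`0 ≤ E_3(μ_p; G₂ ∪ G₃, G₁ ∪ G₃, G₁ ∪ G₂)`. [this work] -/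
theorem sahiE_three_and_or_and_nonneg (p : ι → unitInterval) {S T R : Finset ι} (hST : Disjoint S T) (hSR : Disjoint S R)
    (hTR : Disjoint R T) {G₁ G₂ : Set (Set ι)} (h₁ : IsUpperSet G₁) (h₂ : IsUpperSet G₂) :
    0 ≤ sahiE (bernoulliWeight p) 3
      ![ind (G₂ ∪ ({ω : Set ι | ∀ e ∈ S, e ∈ ω} ∩ ({ω : Set ι | ∃ e ∈ T, e ∈ ω} ∪ {ω : Set ι | ∀ e ∈ R, e ∈ ω}))),
        ind (G₁ ∪ ({ω : Set ι | ∀ e ∈ S, e ∈ ω} ∩ ({ω : Set ι | ∃ e ∈ T, e ∈ ω} ∪ {ω : Set ι | ∀ e ∈ R, e ∈ ω}))),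
        ind (G₁ ∪ G₂)] := by
  refine SahiCoSunflowerAndClosure.good_andClause p S
    ((SahiCoSunflowerOrClosure.isUpperSet_orClause T).union (SahiCoSunflowerAndClosure.isUpperSet_andClause R)) ?_ ?_ G₁ G₂ h₁ h₂
  · intro e he b
    rw [SahiCombDisjunct.secAt_union, SahiCoSunflowerOrClosure.secAt_orClause_of_not_mem (Finset.disjoint_left.1 hST he) b,
      SahiCoSunflowerAndClosure.secAt_andClause_of_not_mem (Finset.disjoint_left.1 hSR he) b]
  · intro G₁ G₂ h₁ h₂
    exact sahiE_three_orClause_andClause_nonneg p hTR h₁ h₂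

/-! ### 3. The reflected form: Kahn's Conjecture 5 for sunflower complements with an OR-clause generator -/

omit [Fintype ι] in
/-- The reflection of the OR-clause is the complement of the AND-clause: `{ω | ∃ e ∈ S, e ∈ ωᶜ} = (C_S)ᶜ`. [folklore] -/
theorem preimage_compl_orClause (S : Finset ι) :
    compl ⁻¹' {ω : Set ι | ∃ e ∈ S, e ∈ ω} = {ω : Set ι | ∀ e ∈ S, e ∈ ω}ᶜ := by
  ext ω
  simp only [Set.mem_preimage, Set.mem_setOf_eq, Set.mem_compl_iff, not_forall]
  constructor
  · rintro ⟨e, he, heω⟩; exact ⟨e, he, heω⟩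
  · rintro ⟨e, he, heω⟩; exact ⟨e, he, heω⟩

/-- **Kahn's Conjecture 5 on the complements of the sunflower `(F₂ ∩ O_S, F₁ ∩ O_S, F₁ ∩ F₂)`**, `O_S = {ω | ω ∩ S ≠ ∅}` an OR-clause of ANY
finite set of coordinates, `F₁, F₂` ARBITRARY increasing events (they may use the coordinates of `S`):
`0 ≤ E_3(μ_p; (F₂ ∩ O_S)ᶜ, (F₁ ∩ O_S)ᶜ, (F₁ ∩ F₂)ᶜ)` for every product measure — the tree's open `(1 + a)(ab − e₂) ≥ e₃` on this stratum.
Proof: reflection `ω ↦ ωᶜ`, `p ↦ 1 − p` (`sahiE3_eq_sahiE3_preimage_compl`) and the AND-clause theorem. [this work] -/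
theorem sahiE3_compl_sunflower_orClause_nonneg (p : ι → unitInterval) (S : Finset ι) {F₁ F₂ : Set (Set ι)} (h₁ : IsUpperSet F₁)
    (h₂ : IsUpperSet F₂) :
    0 ≤ sahiE3 (prodBernoulli p) (F₂ ∩ {ω : Set ι | ∃ e ∈ S, e ∈ ω})ᶜ (F₁ ∩ {ω : Set ι | ∃ e ∈ S, e ∈ ω})ᶜ (F₁ ∩ F₂)ᶜ := by
  rw [Literature.Probability.LatticeModels.sahiE3_eq_sahiE3_preimage_compl p MeasurableSet.of_discrete MeasurableSet.of_discrete
    MeasurableSet.of_discrete, Set.preimage_compl, Set.preimage_compl, Set.preimage_compl, Set.preimage_inter,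
    Set.preimage_inter, Set.preimage_inter, Set.compl_inter, Set.compl_inter, Set.compl_inter, preimage_compl_orClause, compl_compl,
    ← sahiE_three_ind]
  exact SahiCoSunflowerAndClosure.sahiE_three_andClause_nonneg _ S
    (Literature.Probability.LatticeModels.isLowerSet_preimage_compl h₁).compl
    (Literature.Probability.LatticeModels.isLowerSet_preimage_compl h₂).compl

/-! ### 4. `Set`-indexed forms (matching the cylinder notation of `…SahiCoSunflowerCylinder`) -/

omit [Fintype ι] in
/-- For a finite `S`, the cylinder `{S ⊆ ω}` is the AND-clause of `S.toFinset`. [folklore] -/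
theorem cylinder_eq_andClause (S : Set ι) (hS : S.Finite) :
    {ω : Set ι | S ⊆ ω} = {ω : Set ι | ∀ e ∈ hS.toFinset, e ∈ ω} := by
  ext ω
  simp only [Set.mem_setOf_eq, Set.Finite.mem_toFinset]
  rfl

omit [Fintype ι] in
/-- For a finite `S`, `{ω | ¬ S ⊆ ωᶜ}` ("some coordinate of `S` open") is the OR-clause of `S.toFinset`. [folklore] -/
theorem orCylinder_eq_orClause (S : Set ι) (hS : S.Finite) :
    {ω : Set ι | ¬ S ⊆ ωᶜ} = {ω : Set ι | ∃ e ∈ hS.toFinset, e ∈ ω} := by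
  ext ω
  simp only [Set.mem_setOf_eq, Set.Finite.mem_toFinset, Set.subset_def, Set.mem_compl_iff, not_forall, not_not, exists_prop]

/-- **AND-clause theorem, cylinder form.**  For EVERY set of coordinates `S` and ALL increasing `G₁, G₂`:
`0 ≤ E_3(μ_p; G₂ ∪ {S ⊆ ω}, G₁ ∪ {S ⊆ ω}, G₁ ∪ G₂)` (gen 7's `sahiE_three_orCoord_nonneg` is `S = {e}`). [this work] -/
theorem sahiE_three_andCylinder_nonneg (p : ι → unitInterval) (S : Set ι) {G₁ G₂ : Set (Set ι)} (h₁ : IsUpperSet G₁)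
    (h₂ : IsUpperSet G₂) :
    0 ≤ sahiE (bernoulliWeight p) 3 ![ind (G₂ ∪ {ω : Set ι | S ⊆ ω}), ind (G₁ ∪ {ω : Set ι | S ⊆ ω}), ind (G₁ ∪ G₂)] := by
  rw [cylinder_eq_andClause S S.toFinite]
  exact SahiCoSunflowerAndClosure.sahiE_three_andClause_nonneg p _ h₁ h₂

/-- **Kahn's Conjecture 5 for sunflower complements with an OR-cylinder generator, `Set` form**: for EVERY set of coordinates `S` and ALL
increasing `F₁, F₂`, `0 ≤ E_3(μ_p; (F₂ ∩ O_S)ᶜ, (F₁ ∩ O_S)ᶜ, (F₁ ∩ F₂)ᶜ)` with `O_S = {ω | ¬ S ⊆ ωᶜ}` — the companion of gen 8's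
`SahiCoSunflowerCylinder.sahiE3_compl_sunflower_cylinder_nonneg` (`F₃ = {S ⊆ ω}`). [this work] -/
theorem sahiE3_compl_sunflower_orCylinder_nonneg (p : ι → unitInterval) (S : Set ι) {F₁ F₂ : Set (Set ι)} (h₁ : IsUpperSet F₁)
    (h₂ : IsUpperSet F₂) :
    0 ≤ sahiE3 (prodBernoulli p) (F₂ ∩ {ω : Set ι | ¬ S ⊆ ωᶜ})ᶜ (F₁ ∩ {ω : Set ι | ¬ S ⊆ ωᶜ})ᶜ (F₁ ∩ F₂)ᶜ := by
  rw [orCylinder_eq_orClause S S.toFinite]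
  exact sahiE3_compl_sunflower_orClause_nonneg p _ h₁ h₂

end SahiCoSunflowerClauseChains

end Summit.CriticalPhenomena.PercolationContinuityZ3.Theorems
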